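import Summits.KontsevichZagierPeriods.KontsevichZagierPeriods.Theses.Deregularisation
import Summits.KontsevichZagierPeriods.KontsevichZagierPeriods.Theorems.RegKernel2.Negative.SummitConsequence
import Summits.KontsevichZagierPeriods.KontsevichZagierPeriods.Theorems.UnfoldedStokesStokesGenerationStubCubifyKernel
import Literature.NumberTheory.Transcendental.KZRegCalculusProofs
import Literature.NumberTheory.Transcendental.KZKernelConjectureForms

/-!
# Strategy census (kernel-checked part) — crux `DeregularisationShell` (stmt-KontsevichZagierPeriods-3903)

Scratch file of the crux-strategist (cstrat, RESTATED re-audit of route Deregularisation). The crux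
`DeregularisationShell` is the summit in an `∃ L`-costume (refuter evidence on the item:
`Shell ↔ KZKernelConjecture ↔ KontsevichZagierPeriods`). This file types the decompositions that were
tried and checks, for each, WHY it does not qualify for the BC2-redirect exemption — either the
join of the open pieces is subgroup bookkeeping (TRIVIAL-SEAM in the sense of
docs/m5/EXEMPT46-REEXAM-2026-08-17.md §0), or a piece is the parent again modulo a landed theorem
(PIECE-EQUIVALENT). Companion prose: `STRATEGY-CENSUS.md` in the same crux directory.

Contents
* §D1 the sandwich `ker KZ.eval ≤ Λ(KZreg.relations) ≤ KZ.relations`: pieces `RegConservative2`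
  (stmt-4952) and `RegKernel2` (stmt-14491); two assemblies (the route's KZreg instance, 19 lines,
  and the costume-free instance, 8 lines) and the 3-line seam.
* §D2 the move-type refinement of X₁: the join is `KZreg.Conservative.of_subset` (= `closure_le`).
* §D3 cubical reach: `CubeReach ↔ RegKernel2` by the LANDED one-cube normal form
  `stub_cubifyKernel` (route UnfoldedStokes) — the restricted piece is the piece again.
* §D4 the stronger reach `InclKernel` (regularised relation = `incl c` itself): sandwiched
  `KZKernelConjecture → InclKernel → RegKernel2`, same seam with X₁.
* §S1 the dimension-effective strengthening `DimEffectiveReach` (typed; implies `RegKernel2`).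
* §N the negation side in dual form: "every additive move-invariant factors through `eval`" is
  `KZKernelConjecture` itself (`invariantsFactor_iff_kzKernelConjecture`).
-/

noncomputable section

-- `Summit.KontsevichZagierPeriods.KontsevichZagierPeriods.…` is the tree's mandated layout (single-conjunct summit).
set_option linter.dupNamespace false

namespace Summit.KontsevichZagierPeriods.KontsevichZagierPeriods.Cruxes.DeregularisationShell.Census

open Literature.NumberTheory.Transcendental
open Summit.KontsevichZagierPeriods.KontsevichZagierPeriods.Theses.Deregularisation
open Summit.KontsevichZagierPeriods.KontsevichZagierPeriods.Cruxes.StokesGeneration.FibrewiseStokes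
  (stub_cubifyKernel)

/-! ## §D1 The sandwich: X₁ = `RegConservative2`, X₂ = `RegKernel2` -/

/-- **D1 assembly, the route's instance** `L := KZreg.FormalRep`, `rel := KZreg.relations ⊔ defects`
(the bare `rel := KZreg.relations` is refuted: `KZreg.not_kernelConjecture`), `ev := KZreg.eval`,
`ι := incl`, `Λ := KZreg.Λ`. Uses `Λ_incl`, `eval_incl`, `eval_Λ`, `sub_incl_Λ_mem_defects`,
`defects_le_ker_Λ`. 19 lines; the two pieces never interact except through `Λ d' = Λ d`. -/
theorem D1_assembly (h₁ : RegConservative2) (h₂ : RegKernel2) : DeregularisationShell := by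
  refine ⟨KZreg.FormalRep, inferInstance, KZreg.relations ⊔ KZreg.defects, KZreg.eval, KZreg.incl,
    KZreg.Λ, KZreg.Λ_incl, KZreg.eval_incl, ?_, ?_⟩
  · intro d hd
    have h0 : KZ.eval (KZreg.Λ d) = 0 := by rw [KZreg.eval_Λ]; exact hd
    obtain ⟨d', hd', hΛ⟩ := h₂ _ h0
    have hsplit : d = d' + (d - d') := by abel
    rw [hsplit]
    refine AddSubgroup.add_mem_sup hd' ?_
    have hdef : d - d' = (d - KZreg.incl (KZreg.Λ d)) - (d' - KZreg.incl (KZreg.Λ d')) := by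
      rw [hΛ]; abel
    rw [hdef]
    exact sub_mem (KZreg.sub_incl_Λ_mem_defects d) (KZreg.sub_incl_Λ_mem_defects d')
  · intro d hd
    have hle : KZreg.relations ⊔ KZreg.defects ≤ KZ.relations.comap KZreg.Λ := by
      refine sup_le (KZreg.conservative_iff_le_comap.1 h₁) fun x hx => ?_
      rw [AddSubgroup.mem_comap, (AddMonoidHom.mem_ker).1 (KZreg.defects_le_ker_Λ hx)]
      exact zero_mem _
    exact hle hd

/-- **D1 assembly, costume-free**: `L := KZ.FormalRep`, `ι = Λ = id`, `ev := KZ.eval`,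
`rel := Λ(KZreg.relations)`. Then the shell's conjunct `ker ev ≤ rel` is `RegKernel2` VERBATIM and
`Λ rel ≤ KZ.relations` is `RegConservative2` VERBATIM: the shell is `X₁ ∧ X₂` with `rel` fixed. -/
theorem D1_assembly_costumeFree (h₁ : RegConservative2) (h₂ : RegKernel2) :
    DeregularisationShell := by
  refine ⟨KZ.FormalRep, inferInstance, KZreg.relations.map KZreg.Λ, KZ.eval, AddMonoidHom.id _,
    AddMonoidHom.id _, fun _ => rfl, fun _ => rfl, fun c hc => ?_, ?_⟩
  · obtain ⟨d, hd, hdc⟩ := h₂ c hc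
    exact ⟨d, hd, hdc⟩
  · rintro _ ⟨d, hd, rfl⟩
    exact h₁ d hd

/-- **D1 seam.** The only interaction of the two open pieces: modus ponens along
`ker KZ.eval ≤ Λ(KZreg.relations) ≤ KZ.relations` (3 lines; = the landed
`RegKernel2.Negative.regConservative2_and_regKernel2_iff_kzKernelConjecture`, `→`). -/
theorem D1_seam (h₁ : RegConservative2) (h₂ : RegKernel2) : KZKernelConjecture := by
  intro c h0
  obtain ⟨d, hd, rfl⟩ := h₂ c h0
  exact h₁ d hd

/-- Both D1 pieces are consequences of the summit (landed: `KZreg.conservative_of_kzKernelConjecture`,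
`RegKernel2.Negative.summit_consequence`), so with either piece proved the other becomes
summit-EQUIVALENT (the "IslandComplement death"). -/
theorem D1_pieces_of_summit (h : KontsevichZagierPeriods) : RegConservative2 ∧ RegKernel2 :=
  (RegKernel2.Negative.summit_iff_regConservative2_and_regKernel2).1 h

/-! ## §D2 Refining X₁ by move type: the join is `closure_le` -/

/-- Conservativity of `Λ` on the two ADDITIVITY moves of `KZreg` (rule (1) with arbitrary divergent
coordinates): bookkeeping-grade (a.e.-modification on ℚ-semialgebraic null sets + overlap of
thickened faces), plausibly provable, L-size Lean. -/
def AdditivityConservative : Prop :=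
  KZreg.domainAddRel ∪ KZreg.integrandAddRel ⊆ KZreg.Λ ⁻¹' (KZ.relations : Set KZ.FormalRep)

/-- Conservativity of `Λ` on regularised Newton–Leibniz along a non-divergent coordinate:
bookkeeping-grade (cell decomposition of the thickened band by the order of the face bounds
`a_T, b_T`, then KZ rule (3) cellwise), plausibly provable, L-size. -/
def StokesConservative : Prop :=
  KZreg.newtonLeibnizRel ⊆ KZreg.Λ ⁻¹' (KZ.relations : Set KZ.FormalRep)

/-- Conservativity of `Λ` on D-fixing changes of variables: product maps are one KZ change of
variables on the main piece; the `u`-dependent instances (face map ≠ bulk map at the face) are the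
SCALING DEFECTS — this conjunct carries `ScalingDefectPrinciple` (stmt-3905) and Hoffman-type MZV
relations; it is the route's genuine content. -/
def CovConservative : Prop :=
  KZreg.changeOfVariablesRel ⊆ KZreg.Λ ⁻¹' (KZ.relations : Set KZ.FormalRep)

/-- **D2 join** `X₁ ⇐ (additivity) ∧ (Stokes) ∧ (CoV)`: it is `KZreg.Conservative.of_subset`, i.e.
`AddSubgroup.closure_le` — bookkeeping. -/
theorem D2_join (ha : AdditivityConservative) (hs : StokesConservative) (hc : CovConservative) :
    RegConservative2 :=
  KZreg.Conservative.of_subset (fun _ hx => ha (Or.inl hx)) (fun _ hx => ha (Or.inr hx)) hc hs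

/-- **D2 assembly** (4 pieces): `D2_join` followed by `D1_assembly` — no new interaction. -/
theorem D2_assembly (ha : AdditivityConservative) (hs : StokesConservative) (hc : CovConservative)
    (hk : RegKernel2) : DeregularisationShell :=
  D1_assembly (D2_join ha hs hc) hk

/-- All four D2 pieces are consequences of the summit. -/
theorem D2_pieces_of_summit (h : KontsevichZagierPeriods) :
    AdditivityConservative ∧ StokesConservative ∧ CovConservative ∧ RegKernel2 := by
  obtain ⟨hcons, hk⟩ := D1_pieces_of_summit h
  refine ⟨fun d hd => hcons d ?_, fun d hd => hcons d ?_, fun d hd => hcons d ?_, hk⟩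
  · rcases hd with hd | hd
    · exact KZreg.domainAddRel_subset_relations hd
    · exact KZreg.integrandAddRel_subset_relations hd
  · exact KZreg.newtonLeibnizRel_subset_relations hd
  · exact KZreg.changeOfVariablesRel_subset_relations hd

/-! ## §D3 Restricting the reach piece to ONE bounded closed-cube representation -/

/-- `RegKernel2` restricted to the one-cube normal form of route UnfoldedStokes: a single
representation on `[0,1]^M` with bounded integrand and value `0` is reached by de-regularisation. -/
def CubeReach : Prop :=
  ∀ (M : ℕ) (t : KZ.IntegralRep M), t.domain = Set.pi Set.univ (fun _ : Fin M => Set.Icc (0:ℝ) 1) →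
    (∃ B : ℝ, ∀ z ∈ t.domain, |t.integrand z| ≤ B) → t.value = 0 →
    ∃ d ∈ KZreg.relations, KZreg.Λ d = KZ.of t

/-- **D3 collapses**: `CubeReach ↔ RegKernel2`, by the LANDED `stub_cubifyKernel` (every formal
combination is `≡` one bounded cube representation modulo `KZ.relations`), soundness
`KZ.relations_le_ker_eval_holds`, `KZreg.map_relations_le` and `Λ ∘ incl = id`. So the cubical piece
is PIECE-EQUIVALENT to X₂ (evidence class E1: landed converse modulo a landed theorem). -/
theorem D3_cubeReach_iff_regKernel2 : CubeReach ↔ RegKernel2 := by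
  constructor
  · intro h c hc
    obtain ⟨M, t, htd, htB, hct⟩ := stub_cubifyKernel c
    have hval : t.value = 0 := by
      have h0 : KZ.eval (c - KZ.of t) = 0 := KZ.relations_le_ker_eval_holds hct
      rw [map_sub, hc, KZ.eval_of, zero_sub, neg_eq_zero] at h0
      exact h0
    obtain ⟨d₀, hd₀, hΛ₀⟩ := h M t htd htB hval
    refine ⟨d₀ + KZreg.incl (c - KZ.of t), add_mem hd₀ (KZreg.map_relations_le ⟨_, hct, rfl⟩), ?_⟩
    rw [map_add, hΛ₀, KZreg.Λ_incl]
    abel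
  · intro h M t _ _ hval
    exact h (KZ.of t) (by rw [KZ.eval_of]; exact hval)

/-! ## §D4 The stronger reach: the regularised relation is `incl c` itself -/

/-- `InclKernel`: every vanishing combination of convergent representations, included into the
regularised calculus, IS a regularised relation (no defect correction allowed). -/
def InclKernel : Prop :=
  ∀ c : KZ.FormalRep, KZ.eval c = 0 → KZreg.incl c ∈ KZreg.relations

/-- `KZKernelConjecture → InclKernel` (`map_relations_le`). -/
theorem inclKernel_of_kzKernelConjecture (hk : KZKernelConjecture) : InclKernel :=
  fun c hc => KZreg.map_relations_le ⟨c, hk c hc, rfl⟩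

/-- `InclKernel → RegKernel2` (`Λ ∘ incl = id`). -/
theorem regKernel2_of_inclKernel (h : InclKernel) : RegKernel2 :=
  fun c hc => ⟨KZreg.incl c, h c hc, KZreg.Λ_incl c⟩

/-- … and the same seam: `InclKernel ∧ X₁ → KZKernelConjecture` in two lines. -/
theorem D4_seam (h₁ : RegConservative2) (h : InclKernel) : KZKernelConjecture := by
  intro c hc
  simpa only [KZreg.Λ_incl] using h₁ _ (h c hc)

/-! ## §S1 Strengthening with a dimension budget (typed; implies X₂, no inductive mechanism) -/

/-- Formal combinations of KZ representations of dimension `≤ n`. -/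
def suppDim (n : ℕ) : AddSubgroup KZ.FormalRep :=
  AddSubgroup.closure ((fun p : Σ m, KZ.IntegralRep m => FreeAbelianGroup.of p) '' {p | p.1 ≤ n})

/-- Formal combinations of regularised representations of dimension `≤ n`. -/
def regSuppDim (n : ℕ) : AddSubgroup KZreg.FormalRep :=
  AddSubgroup.closure ((fun p : Σ m, KZreg.IntegralRep m => FreeAbelianGroup.of p) '' {p | p.1 ≤ n})

theorem suppDim_mono {m n : ℕ} (h : m ≤ n) : suppDim m ≤ suppDim n :=
  AddSubgroup.closure_mono (Set.image_mono fun _ hp => le_trans hp h)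

/-- Every formal combination has a dimension budget. -/
theorem exists_mem_suppDim (c : KZ.FormalRep) : ∃ n, c ∈ suppDim n := by
  induction c using FreeAbelianGroup.induction_on with
  | zero => exact ⟨0, zero_mem _⟩
  | of p => exact ⟨p.1, AddSubgroup.subset_closure ⟨p, show p.1 ≤ p.1 from le_rfl, rfl⟩⟩
  | neg p hp =>
    obtain ⟨n, hn⟩ := hp
    exact ⟨n, neg_mem hn⟩
  | add x y hx hy =>
    obtain ⟨n, hn⟩ := hx
    obtain ⟨m, hm⟩ := hy
    exact ⟨max n m, add_mem (suppDim_mono (le_max_left _ _) hn) (suppDim_mono (le_max_right _ _) hm)⟩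

/-- **S⁺ (dimension-effective reach)**: a vanishing combination in dimension `≤ n` is the
de-regularisation of a regularised relation that is itself a combination of MOVE INSTANCES each
supported in dimension `≤ n + 1`. Not implied by the summit (no dimension control of KZ chains is
known), admits no induction on `n` (no operation lowers the dimension of a general kernel element),
and its only use toward the crux is the specialisation below. -/
def DimEffectiveReach : Prop :=
  ∀ (n : ℕ) (c : KZ.FormalRep), c ∈ suppDim n → KZ.eval c = 0 →
    ∃ d ∈ KZreg.relations ⊓ AddSubgroup.closure
        ((KZreg.domainAddRel ∪ KZreg.integrandAddRel ∪ KZreg.changeOfVariablesRel ∪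
          KZreg.newtonLeibnizRel) ∩ (regSuppDim (n + 1) : Set KZreg.FormalRep)),
      KZreg.Λ d = c

/-- The strengthening only feeds the crux through `RegKernel2` (forget the budget). -/
theorem regKernel2_of_dimEffectiveReach (h : DimEffectiveReach) : RegKernel2 := by
  intro c hc
  obtain ⟨n, hn⟩ := exists_mem_suppDim c
  obtain ⟨d, hd, hdc⟩ := h n c hn hc
  exact ⟨d, hd.1, hdc⟩

/-! ## §N Negation, dual form: a non-value additive invariant would refute the summit — and its
non-existence IS the summit -/

/-- "Every additive invariant of the four move sets factors through the value": for every abelian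
group `A` and additive `φ` killing `KZ.relations`, `φ` kills `ker eval`. -/
def InvariantsFactorThroughEval : Prop :=
  ∀ (A : Type) [AddCommGroup A] (φ : KZ.FormalRep →+ A), KZ.relations ≤ φ.ker → KZ.eval.ker ≤ φ.ker

/-- **The dual form is the kernel conjecture itself** (take `φ` = the quotient map by
`KZ.relations`). So "construct a separating invariant" (route Neg) is `¬` summit, and "no separating
invariant exists" is the summit: the negation lens yields no stub short of either. -/
theorem invariantsFactor_iff_kzKernelConjecture : InvariantsFactorThroughEval ↔ KZKernelConjecture := by
  constructor
  · intro h c hc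
    have hker : KZ.relations ≤ (QuotientAddGroup.mk' KZ.relations).ker := by
      rw [QuotientAddGroup.ker_mk']
    have := h (KZ.FormalRep ⧸ KZ.relations) (QuotientAddGroup.mk' KZ.relations) hker
      ((AddMonoidHom.mem_ker).2 hc)
    rwa [QuotientAddGroup.ker_mk'] at this
  · intro hk A _ φ hφ c hc
    exact hφ (hk c ((AddMonoidHom.mem_ker).1 hc))

end Summit.KontsevichZagierPeriods.KontsevichZagierPeriods.Cruxes.DeregularisationShell.Census
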